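import Summits.CriticalPhenomena.PercolationContinuityZ3.Theorems.PercNearOneGluingAdditiveGluingFingerTwoContactsBFacts
import Summits.CriticalPhenomena.PercolationContinuityZ3.Theorems.PercNearOneGluingAdditiveGluingFingerTwoContactsBValues
import Summits.CriticalPhenomena.PercolationContinuityZ3.Theorems.PercNearOneGluingAdditiveGluingFingerTwoContactsBSetup
import HarnessLib

/-! # Crux `PercNearOneGluing.AdditiveGluing` (stmt-CriticalPhenomena-4576) — the finger multi-edge Lemma 3 for TWO base-weak contact relays
# when the fingers may also touch the target `b` (seat (b) V⁺-form, depth prover `png-dp-vplus`)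

Support file (`--supports stmt-CriticalPhenomena-4576`); no definitions, no named facts.  Companion of `…AdditiveGluingFingerTwoContacts.lean`
(`fingerML3_twoContacts_core`, which needs NO finger at `b`); this file removes that restriction, the last obstruction to the registered open
stub `stub_fingerML3_vp` for `|A| ≤ 4`.

**Theorem (`fingerML3_twoContactsB_core`).**  `K` a weighting on `Fin n`; a finger block `N` (fingers pairwise non-adjacent) whose fingers
have positive-weight pairs only to `w₁, w₂, b` (all ∉ `N`, distinct, and distinct from the untouched designation `d ∉ N`); the stub's unglued
hypotheses `μ_K(d↔b) ≤ μ_K(w_i↔b)` and (non-strict) base weakness `μ_q(w_i↔b) ≤ μ_q(d↔b)`, `q` = `K` with the pairs at `N` killed.  Then with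
`F` = the contact pairs and `R` = "some pair of `F` open": `μ_{K/N}(R ∩ {d↔b}) ≤ μ_{K/N}(R ∩ ⋃_{v∈N}{v↔b})`.

**Proof (a three-term certificate).**  Expand both sides and the two hypotheses `H_i = μ_K(w_i↔b) − μ_K(d↔b) ≥ 0` over the patterns `T` of
`F` (`…FingerPatternValues`): every pattern value is the `q`-probability of a connectivity event among `b, d, w₁, w₂` in the pairs avoiding
the block (`tcb_reach_union_tri_iff`), classified by the touched set (glued side: 7 classes `g*`) resp. the bridge partition (unglued side:
5 classes `u*`).  With `S = Σ cyl = 1 − c₀`, `D₁ = c₀ + u₀ + u₂` (= `1 −` P(`w₁` bridged)) and, in the case `u₂ ≤ u₁`,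
`λ₁ = g₁/D₁`, `λ₂ = S − λ₁`, `y₂ = λ₂(c₀+u₀+u₁) − g₂`, the combination `target − λ₁H₁ − λ₂H₂ − y₂·ROW` — where
`ROW = μ_q(d↔b, d↔w₁) − μ_q(w₂↔b, d↔w₁) ≥ 0` is Kozma–Nitzan's Lemma 3(i) in the base for the weak pair `w₂ < d` localised to `{d ↔ w₁}`
(`knLemma3i`) — has a pointwise non-negative integrand (`tcb_twoContactsB_pointwise`, 15 connectivity classes), given `λ's, y₂ ≥ 0` and the
leaf inequalities, which follow from: Harris (`R` increasing, "no bridge" decreasing: `u₀ ≤ S(u₀+c₀)`), the termwise class comparisons, and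
the coordinate-block swap inequality `g₁u₁ ≤ D₁(g_b + g₁b)` (`tcb_swap_sum_le`).  The case `u₁ ≤ u₂` is the mirror image.
Numerically the certificate was found by LP over fake base measures and verified exactly on 770 finger systems (seat notes, lab/bfinal2.py).
[cite: KozmaNitzan2024, Lemma 3 (pp. 6–7), §3.1, §3.2 pp. 12–14, §4 p. 20, Question 9 (p. 36)]
[cite: VandenbergHaggstromKahn2005, Thms. 1.3–1.4 (pp. 6–7); Grimmett1999, Thm. (2.4) p. 34]
-/

namespace Summit.CriticalPhenomena.PercolationContinuityZ3.Theorems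

open MeasureTheory Set
open Literature.Probability.LatticeModels (prodBernoulli)
open Literature.Probability.Percolation (BondConfig openConn openGraph pinW localCylinder DeterminedBy determinedBy_iff)

noncomputable section
open Classical

section TwoContactsBCore

open Literature.Probability.LatticeModels Literature.Probability.Percolation

variable {n : ℕ}

set_option maxHeartbeats 4000000 in
/-- **FML3 for two base-weak contact relays, fingers may touch `b`** (see the module docstring): finger block `N` with contacts only to
`w₁, w₂, b`, untouched designation `d`, unglued hypotheses at `w₁, w₂`, non-strict base weakness of `w₁, w₂`; then
`μ_{K/N}(R ∩ {d↔b}) ≤ μ_{K/N}(R ∩ ⋃_{v∈N}{v↔b})`.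
[cite: KozmaNitzan2024, Lemma 3 (pp. 6–7), §3.1, §3.2 pp. 12–14, §4 p. 20] -/
theorem fingerML3_twoContactsB_core (K : Sym2 (Fin n) → unitInterval) (N : Finset (Fin n)) (w₁ w₂ d b : Fin n)
    (hw₁ : w₁ ∉ N) (hw₂ : w₂ ∉ N) (hdN : d ∉ N) (hbN : b ∉ N)
    (h12 : w₁ ≠ w₂) (h1b : w₁ ≠ b) (h2b : w₂ ≠ b)
    (hint : ∀ v ∈ N, ∀ v' ∈ N, v ≠ v' → K s(v, v') = 0)
    (hcont : ∀ v ∈ N, ∀ z : Fin n, z ∉ N → z ≠ w₁ → z ≠ w₂ → z ≠ b → K s(v, z) = 0)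
    (hle₁ : (prodBernoulli K).real (openConn d b) ≤ (prodBernoulli K).real (openConn w₁ b))
    (hle₂ : (prodBernoulli K).real (openConn d b) ≤ (prodBernoulli K).real (openConn w₂ b))
    (hweak₁ : (prodBernoulli (fun e : Sym2 (Fin n) => if (∃ z ∈ e, z ∈ N) then (0 : unitInterval) else K e)).real (openConn w₁ b) ≤
      (prodBernoulli (fun e : Sym2 (Fin n) => if (∃ z ∈ e, z ∈ N) then (0 : unitInterval) else K e)).real (openConn d b))
    (hweak₂ : (prodBernoulli (fun e : Sym2 (Fin n) => if (∃ z ∈ e, z ∈ N) then (0 : unitInterval) else K e)).real (openConn w₂ b) ≤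
      (prodBernoulli (fun e : Sym2 (Fin n) => if (∃ z ∈ e, z ∈ N) then (0 : unitInterval) else K e)).real (openConn d b)) :
    (prodBernoulli (fun e' : Sym2 (Fin n) => if (∀ z ∈ e', z ∈ N) ∧ ¬ e'.IsDiag then 1 else K e')).real
        ({ω : Set (Sym2 (Fin n)) | ∃ e ∈ N.image (fun v => s(v, w₁)) ∪ N.image (fun v => s(v, w₂)) ∪ N.image (fun v => s(v, b)),
            e ∈ ω} ∩ openConn d b) ≤
      (prodBernoulli (fun e' : Sym2 (Fin n) => if (∀ z ∈ e', z ∈ N) ∧ ¬ e'.IsDiag then 1 else K e')).real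
        ({ω : Set (Sym2 (Fin n)) | ∃ e ∈ N.image (fun v => s(v, w₁)) ∪ N.image (fun v => s(v, w₂)) ∪ N.image (fun v => s(v, b)),
            e ∈ ω} ∩ ⋃ v ∈ N, openConn v b) := by
  set F : Finset (Sym2 (Fin n)) := N.image (fun v => s(v, w₁)) ∪ N.image (fun v => s(v, w₂)) ∪ N.image (fun v => s(v, b))
    with hFdef
  set g : Sym2 (Fin n) → unitInterval := fun e' => if (∀ z ∈ e', z ∈ N) ∧ ¬ e'.IsDiag then 1 else K e' with hg
  set q : Sym2 (Fin n) → unitInterval := fun e => if (∃ z ∈ e, z ∈ N) then (0 : unitInterval) else K e with hq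
  have hmeas : ∀ s : Set (BondConfig (Fin n)), MeasurableSet s := fun _ => MeasurableSet.of_discrete
  -- membership in `F`, weights at the block outside `F`
  obtain ⟨hFmem, hF, hmemF, hK0, hK0'⟩ := tcb_contacts K N F w₁ w₂ b hw₁ hw₂ hbN hint hcont hFdef
  have hgK : ∀ e ∈ (↑F : Set (Sym2 (Fin n))), g e = K e := by
    intro e he
    have hnot := contactPair_not_internal N F hF e (Finset.mem_coe.1 he)
    have : ¬ ((∀ z ∈ e, z ∈ N) ∧ ¬ e.IsDiag) := fun h => hnot h.1
    simp only [hg, this, if_false]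
  -- the event `R` and the pattern sum over it
  obtain ⟨S, hS, hSin, hsum⟩ := tcb_patterns F
  set R : Set (BondConfig (Fin n)) := {ω : Set (Sym2 (Fin n)) | ∃ e ∈ F, e ∈ ω} with hR
  set cyl : Finset (Sym2 (Fin n)) → ℝ := fun T => (prodBernoulli K).real (localCylinder (↑F : Set (Sym2 (Fin n))) ↑T) with hcyl
  have hcyl_nonneg : ∀ T, 0 ≤ cyl T := fun T => measureReal_nonneg
  have hcylg : ∀ T : Finset (Sym2 (Fin n)), (prodBernoulli g).real (localCylinder (↑F : Set (Sym2 (Fin n))) ↑T) = cyl T :=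
    fun T => prodBernoulli_real_eq_of_determinedBy g K hgK (determinedBy_localCylinder _ _) (hmeas _)
  -- touched / bridged predicates of a pattern
  set t1 : Finset (Sym2 (Fin n)) → Prop := fun T => ∃ v ∈ N, s(v, w₁) ∈ T with ht1
  set t2 : Finset (Sym2 (Fin n)) → Prop := fun T => ∃ v ∈ N, s(v, w₂) ∈ T with ht2
  set tb : Finset (Sym2 (Fin n)) → Prop := fun T => ∃ v ∈ N, s(v, b) ∈ T with htb
  set b12 : Finset (Sym2 (Fin n)) → Prop := fun T => ∃ v ∈ N, s(v, w₁) ∈ T ∧ s(v, w₂) ∈ T with hb12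
  set b1 : Finset (Sym2 (Fin n)) → Prop := fun T => ∃ v ∈ N, s(v, w₁) ∈ T ∧ s(v, b) ∈ T with hb1
  set b2 : Finset (Sym2 (Fin n)) → Prop := fun T => ∃ v ∈ N, s(v, w₂) ∈ T ∧ s(v, b) ∈ T with hb2
  have hJform : ∀ T, T ⊆ F → ∀ e ∈ T, ∃ v ∈ N, e = s(v, w₁) ∨ e = s(v, w₂) ∨ e = s(v, b) :=
    fun T hTF e he => hFmem e (hTF he)
  -- the base events (connectivity among `b, d, w₁, w₂` in the pairs of `ω` avoiding the block)
  set Edb : Set (BondConfig (Fin n)) := {ω | (openGraph ({e | e ∈ ω ∧ ∀ z ∈ e, z ∉ N} : Set (Sym2 (Fin n)))).Reachable d b} with hEdb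
  set E1b : Set (BondConfig (Fin n)) := {ω | (openGraph ({e | e ∈ ω ∧ ∀ z ∈ e, z ∉ N} : Set (Sym2 (Fin n)))).Reachable w₁ b} with hE1b
  set E2b : Set (BondConfig (Fin n)) := {ω | (openGraph ({e | e ∈ ω ∧ ∀ z ∈ e, z ∉ N} : Set (Sym2 (Fin n)))).Reachable w₂ b} with hE2b
  set E12u : Set (BondConfig (Fin n)) := {ω | (openGraph ({e | e ∈ ω ∧ ∀ z ∈ e, z ∉ N} : Set (Sym2 (Fin n)))).Reachable w₁ b ∨
    (openGraph ({e | e ∈ ω ∧ ∀ z ∈ e, z ∉ N} : Set (Sym2 (Fin n)))).Reachable w₂ b} with hE12u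
  set Ed12 : Set (BondConfig (Fin n)) := {ω | (openGraph ({e | e ∈ ω ∧ ∀ z ∈ e, z ∉ N} : Set (Sym2 (Fin n)))).Reachable d b ∨
    ((openGraph ({e | e ∈ ω ∧ ∀ z ∈ e, z ∉ N} : Set (Sym2 (Fin n)))).Reachable w₂ b ∧
      (openGraph ({e | e ∈ ω ∧ ∀ z ∈ e, z ∉ N} : Set (Sym2 (Fin n)))).Reachable d w₁) ∨
    ((openGraph ({e | e ∈ ω ∧ ∀ z ∈ e, z ∉ N} : Set (Sym2 (Fin n)))).Reachable w₁ b ∧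
      (openGraph ({e | e ∈ ω ∧ ∀ z ∈ e, z ∉ N} : Set (Sym2 (Fin n)))).Reachable d w₂)} with hEd12
  set Ed1b : Set (BondConfig (Fin n)) := {ω | (openGraph ({e | e ∈ ω ∧ ∀ z ∈ e, z ∉ N} : Set (Sym2 (Fin n)))).Reachable d b ∨
    (openGraph ({e | e ∈ ω ∧ ∀ z ∈ e, z ∉ N} : Set (Sym2 (Fin n)))).Reachable d w₁} with hEd1b
  set Ed2b : Set (BondConfig (Fin n)) := {ω | (openGraph ({e | e ∈ ω ∧ ∀ z ∈ e, z ∉ N} : Set (Sym2 (Fin n)))).Reachable d b ∨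
    (openGraph ({e | e ∈ ω ∧ ∀ z ∈ e, z ∉ N} : Set (Sym2 (Fin n)))).Reachable d w₂} with hEd2b
  set Ed12b : Set (BondConfig (Fin n)) := {ω | (openGraph ({e | e ∈ ω ∧ ∀ z ∈ e, z ∉ N} : Set (Sym2 (Fin n)))).Reachable d b ∨
    (openGraph ({e | e ∈ ω ∧ ∀ z ∈ e, z ∉ N} : Set (Sym2 (Fin n)))).Reachable d w₁ ∨
    (openGraph ({e | e ∈ ω ∧ ∀ z ∈ e, z ∉ N} : Set (Sym2 (Fin n)))).Reachable d w₂} with hEd12b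
  set E1b12 : Set (BondConfig (Fin n)) := {ω | (openGraph ({e | e ∈ ω ∧ ∀ z ∈ e, z ∉ N} : Set (Sym2 (Fin n)))).Reachable w₁ b ∨
    (openGraph ({e | e ∈ ω ∧ ∀ z ∈ e, z ∉ N} : Set (Sym2 (Fin n)))).Reachable w₁ w₂} with hE1b12
  set E2b12 : Set (BondConfig (Fin n)) := {ω | (openGraph ({e | e ∈ ω ∧ ∀ z ∈ e, z ∉ N} : Set (Sym2 (Fin n)))).Reachable w₂ b ∨
    (openGraph ({e | e ∈ ω ∧ ∀ z ∈ e, z ∉ N} : Set (Sym2 (Fin n)))).Reachable w₂ w₁} with hE2b12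
  -- pattern reliabilities (`tcb_values`)
  obtain ⟨hvK_d, hvK_1, hvK_2, hvg_d, hvg_1, hvg_2, hvgU_b, hvgU_1, hvgU_2⟩ :
    (∀ T, T ⊆ F → (prodBernoulli (pinW K (↑F : Set (Sym2 (Fin n))) ↑T)).real (openConn d b) =
      (if ((b12 T ∧ b1 T) ∨ (b12 T ∧ b2 T) ∨ (b1 T ∧ b2 T)) then (prodBernoulli q).real Ed12b
        else if b12 T then (prodBernoulli q).real Ed12 else if b1 T then (prodBernoulli q).real Ed1b
        else if b2 T then (prodBernoulli q).real Ed2b else (prodBernoulli q).real Edb)) ∧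
    (∀ T, T ⊆ F → (prodBernoulli (pinW K (↑F : Set (Sym2 (Fin n))) ↑T)).real (openConn w₁ b) =
      (if ((b12 T ∧ b1 T) ∨ (b12 T ∧ b2 T) ∨ (b1 T ∧ b2 T)) then 1
        else if b12 T then (prodBernoulli q).real E12u else if b1 T then 1
        else if b2 T then (prodBernoulli q).real E1b12 else (prodBernoulli q).real E1b)) ∧
    (∀ T, T ⊆ F → (prodBernoulli (pinW K (↑F : Set (Sym2 (Fin n))) ↑T)).real (openConn w₂ b) =
      (if ((b12 T ∧ b1 T) ∨ (b12 T ∧ b2 T) ∨ (b1 T ∧ b2 T)) then 1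
        else if b12 T then (prodBernoulli q).real E12u else if b1 T then (prodBernoulli q).real E2b12
        else if b2 T then 1 else (prodBernoulli q).real E2b)) ∧
    (∀ T, T ⊆ F → (prodBernoulli (pinW g (↑F : Set (Sym2 (Fin n))) ↑T)).real (openConn d b) =
      (if (((t1 T ∧ t2 T) ∧ (t1 T ∧ tb T)) ∨ ((t1 T ∧ t2 T) ∧ (t2 T ∧ tb T)) ∨ ((t1 T ∧ tb T) ∧ (t2 T ∧ tb T)))
        then (prodBernoulli q).real Ed12b
        else if (t1 T ∧ t2 T) then (prodBernoulli q).real Ed12 else if (t1 T ∧ tb T) then (prodBernoulli q).real Ed1b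
        else if (t2 T ∧ tb T) then (prodBernoulli q).real Ed2b else (prodBernoulli q).real Edb)) ∧
    (∀ T, T ⊆ F → ¬ tb T → t1 T → (prodBernoulli (pinW g (↑F : Set (Sym2 (Fin n))) ↑T)).real (openConn w₁ b) =
      (if t2 T then (prodBernoulli q).real E12u else (prodBernoulli q).real E1b)) ∧
    (∀ T, T ⊆ F → ¬ tb T → ¬ t1 T → t2 T → (prodBernoulli (pinW g (↑F : Set (Sym2 (Fin n))) ↑T)).real (openConn w₂ b) =
      (prodBernoulli q).real E2b) ∧
    (∀ T, T ⊆ F → tb T →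
      (prodBernoulli (pinW g (↑F : Set (Sym2 (Fin n))) ↑T)).real (⋃ v ∈ N, openConn v b) = 1) ∧
    (∀ T, T ⊆ F → ¬ tb T → t1 T →
      (prodBernoulli (pinW g (↑F : Set (Sym2 (Fin n))) ↑T)).real (⋃ v ∈ N, openConn v b) =
        (if t2 T then (prodBernoulli q).real E12u else (prodBernoulli q).real E1b)) ∧
    (∀ T, T ⊆ F → ¬ tb T → ¬ t1 T → t2 T →
      (prodBernoulli (pinW g (↑F : Set (Sym2 (Fin n))) ↑T)).real (⋃ v ∈ N, openConn v b) = (prodBernoulli q).real E2b) :=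
    tcb_values K N F w₁ w₂ d b hw₁ hw₂ hdN hbN h12 h1b h2b hF hJform hK0 hK0'
  -- abbreviations for the base quantities
  set A0d := (prodBernoulli q).real Edb with hA0d
  set A01 := (prodBernoulli q).real E1b with hA01
  set A02 := (prodBernoulli q).real E2b with hA02
  set A12u := (prodBernoulli q).real E12u with hA12u
  set A12d := (prodBernoulli q).real Ed12 with hA12d
  set A1bd := (prodBernoulli q).real Ed1b with hA1bd
  set A2bd := (prodBernoulli q).real Ed2b with hA2bd
  set A12bd := (prodBernoulli q).real Ed12b with hA12bd
  set A1b12 := (prodBernoulli q).real E1b12 with hA1b12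
  set A2b12 := (prodBernoulli q).real E2b12 with hA2b12
  -- the no-contact cylinder
  have hRc : Rᶜ = localCylinder (↑F : Set (Sym2 (Fin n))) (∅ : Set (Sym2 (Fin n))) := notSomeOpen_eq_localCylinder F
  set c0 : ℝ := (prodBernoulli K).real (localCylinder (↑F : Set (Sym2 (Fin n))) (∅ : Set (Sym2 (Fin n)))) with hc0
  have hc0_nonneg : 0 ≤ c0 := measureReal_nonneg
  have hempty : ∀ (x y : Fin n), ¬ (∃ v ∈ N, s(v, x) ∈ (∅ : Finset (Sym2 (Fin n))) ∧ s(v, y) ∈ (∅ : Finset (Sym2 (Fin n)))) := by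
    rintro x y ⟨v, -, h, -⟩
    simp at h
  have hpin0_d : (prodBernoulli (pinW K (↑F : Set (Sym2 (Fin n))) (∅ : Set (Sym2 (Fin n))))).real (openConn d b) = A0d := by
    have h := hvK_d ∅ (Finset.empty_subset F)
    rw [Finset.coe_empty] at h
    rw [h]
    have e1 : ¬ b12 ∅ := hempty w₁ w₂
    have e2 : ¬ b1 ∅ := hempty w₁ b
    have e3 : ¬ b2 ∅ := hempty w₂ b
    simp only [e1, e2, e3, and_false, or_false, if_false]
  have hpin0_1 : (prodBernoulli (pinW K (↑F : Set (Sym2 (Fin n))) (∅ : Set (Sym2 (Fin n))))).real (openConn w₁ b) = A01 := by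
    have h := hvK_1 ∅ (Finset.empty_subset F)
    rw [Finset.coe_empty] at h
    rw [h]
    have e1 : ¬ b12 ∅ := hempty w₁ w₂
    have e2 : ¬ b1 ∅ := hempty w₁ b
    have e3 : ¬ b2 ∅ := hempty w₂ b
    simp only [e1, e2, e3, and_false, or_false, if_false]
  have hpin0_2 : (prodBernoulli (pinW K (↑F : Set (Sym2 (Fin n))) (∅ : Set (Sym2 (Fin n))))).real (openConn w₂ b) = A02 := by
    have h := hvK_2 ∅ (Finset.empty_subset F)
    rw [Finset.coe_empty] at h
    rw [h]
    have e1 : ¬ b12 ∅ := hempty w₁ w₂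
    have e2 : ¬ b1 ∅ := hempty w₁ b
    have e3 : ¬ b2 ∅ := hempty w₂ b
    simp only [e1, e2, e3, and_false, or_false, if_false]
  -- unglued reliabilities expanded over the patterns
  have hτ : ∀ (y : Fin n) (v0 : ℝ) (val : Finset (Sym2 (Fin n)) → ℝ),
      (∀ T, T ⊆ F → (prodBernoulli (pinW K (↑F : Set (Sym2 (Fin n))) ↑T)).real (openConn y b) = val T) →
      (prodBernoulli (pinW K (↑F : Set (Sym2 (Fin n))) (∅ : Set (Sym2 (Fin n))))).real (openConn y b) = v0 →
      (prodBernoulli K).real (openConn y b) = (∑ T ∈ S, cyl T * val T) + c0 * v0 := by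
    intro y v0 val hval hv0
    have hs := measureReal_inter_add_sdiff (μ := prodBernoulli K) (s := (openConn y b : Set (BondConfig (Fin n)))) (hmeas R)
    rw [Set.sdiff_eq, hRc, prodBernoulli_real_inter_localCylinder K F ∅ (hmeas _), hv0, hsum K] at hs
    rw [← hs]
    congr 1
    refine Finset.sum_congr rfl fun T hT => ?_
    rw [hval T (hS T hT).1]
  have hτd := hτ d A0d _ hvK_d hpin0_d
  have hτ1 := hτ w₁ A01 _ hvK_1 hpin0_1
  have hτ2 := hτ w₂ A02 _ hvK_2 hpin0_2
  -- total mass of the patterns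
  have hmass : (∑ T ∈ S, cyl T) + c0 = 1 := by
    have hs := measureReal_inter_add_sdiff (μ := prodBernoulli K) (s := (Set.univ : Set (BondConfig (Fin n)))) (hmeas R)
    rw [Set.sdiff_eq, hRc, prodBernoulli_real_inter_localCylinder K F ∅ (hmeas _), hsum K, probReal_univ, probReal_univ,
      mul_one] at hs
    rw [← hs]
    congr 1
    refine Finset.sum_congr rfl fun T _ => ?_
    rw [probReal_univ, mul_one]
  set Stot : ℝ := ∑ T ∈ S, cyl T with hStot
  have hStot0 : 0 ≤ Stot := Finset.sum_nonneg fun T _ => hcyl_nonneg T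
  -- touched patterns
  have htouched : ∀ T ∈ S, t1 T ∨ t2 T ∨ tb T := by
    intro T hT
    obtain ⟨-, e, heF, heT⟩ := hS T hT
    obtain ⟨v, hv, h⟩ := hFmem e heF
    rcases h with rfl | rfl | rfl
    · exact Or.inl ⟨v, hv, heT⟩
    · exact Or.inr (Or.inl ⟨v, hv, heT⟩)
    · exact Or.inr (Or.inr ⟨v, hv, heT⟩)
  -- glued sides expanded over the patterns
  have hgd : (prodBernoulli g).real (R ∩ openConn d b) = ∑ T ∈ S, cyl T *
      (if (((t1 T ∧ t2 T) ∧ (t1 T ∧ tb T)) ∨ ((t1 T ∧ t2 T) ∧ (t2 T ∧ tb T)) ∨ ((t1 T ∧ tb T) ∧ (t2 T ∧ tb T))) then A12bd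
        else if (t1 T ∧ t2 T) then A12d else if (t1 T ∧ tb T) then A1bd else if (t2 T ∧ tb T) then A2bd else A0d) := by
    rw [Set.inter_comm, hsum g]
    refine Finset.sum_congr rfl fun T hT => ?_
    rw [hcylg T, hvg_d T (hS T hT).1]
  have hgU : (prodBernoulli g).real (R ∩ ⋃ v ∈ N, openConn v b) = ∑ T ∈ S, cyl T *
      (if tb T then (if t1 T then (if t2 T then (1 : ℝ) else 1) else (if t2 T then 1 else 1))
        else (if t1 T then (if t2 T then A12u else A01) else A02)) := by
    rw [Set.inter_comm, hsum g]
    refine Finset.sum_congr rfl fun T hT => ?_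
    rw [hcylg T]
    by_cases htbT : tb T
    · rw [hvgU_b T (hS T hT).1 htbT, if_pos htbT]
      split_ifs <;> rfl
    · rw [if_neg htbT]
      by_cases h1T : t1 T
      · rw [hvgU_1 T (hS T hT).1 htbT h1T, if_pos h1T]
      · have h2T : t2 T := ((htouched T hT).resolve_left h1T).resolve_right htbT
        rw [hvgU_2 T (hS T hT).1 htbT h1T h2T, if_neg h1T]
  -- aggregated pattern masses (five unglued classes, seven glued classes)
  have hKd_sum := tcb_nest5_sum S cyl (fun T => (b12 T ∧ b1 T) ∨ (b12 T ∧ b2 T) ∨ (b1 T ∧ b2 T)) b12 b1 b2 A12bd A12d A1bd A2bd A0d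
  have hK1_sum := tcb_nest5_sum S cyl (fun T => (b12 T ∧ b1 T) ∨ (b12 T ∧ b2 T) ∨ (b1 T ∧ b2 T)) b12 b1 b2 1 A12u 1 A1b12 A01
  have hK2_sum := tcb_nest5_sum S cyl (fun T => (b12 T ∧ b1 T) ∨ (b12 T ∧ b2 T) ∨ (b1 T ∧ b2 T)) b12 b1 b2 1 A12u A2b12 1 A02
  have hKone := tcb_nest5_sum S cyl (fun T => (b12 T ∧ b1 T) ∨ (b12 T ∧ b2 T) ∨ (b1 T ∧ b2 T)) b12 b1 b2 1 1 1 1 1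
  beta_reduce at hKd_sum hK1_sum hK2_sum hKone
  set uc : ℝ := ∑ T ∈ S, cyl T * (if ((b12 T ∧ b1 T) ∨ (b12 T ∧ b2 T) ∨ (b1 T ∧ b2 T)) then (1 : ℝ) else 0) with huc
  set u12 : ℝ := ∑ T ∈ S, cyl T * (if ((b12 T ∧ b1 T) ∨ (b12 T ∧ b2 T) ∨ (b1 T ∧ b2 T)) then (0 : ℝ) else if b12 T then 1 else 0)
    with hu12
  set u1 : ℝ := ∑ T ∈ S, cyl T *
    (if ((b12 T ∧ b1 T) ∨ (b12 T ∧ b2 T) ∨ (b1 T ∧ b2 T)) then (0 : ℝ) else if b12 T then 0 else if b1 T then 1 else 0) with hu1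
  set u2 : ℝ := ∑ T ∈ S, cyl T *
    (if ((b12 T ∧ b1 T) ∨ (b12 T ∧ b2 T) ∨ (b1 T ∧ b2 T)) then (0 : ℝ) else if b12 T then 0 else if b1 T then 0
      else if b2 T then 1 else 0) with hu2
  set u0 : ℝ := ∑ T ∈ S, cyl T *
    (if ((b12 T ∧ b1 T) ∨ (b12 T ∧ b2 T) ∨ (b1 T ∧ b2 T)) then (0 : ℝ) else if b12 T then 0 else if b1 T then 0
      else if b2 T then 0 else 1) with hu0
  have hSU : ∑ T ∈ S, cyl T = uc + u12 + u1 + u2 + u0 := by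
    have hone : ∀ T, (if ((b12 T ∧ b1 T) ∨ (b12 T ∧ b2 T) ∨ (b1 T ∧ b2 T)) then (1 : ℝ) else if b12 T then 1 else if b1 T then 1
        else if b2 T then 1 else 1) = 1 := fun T => by split_ifs <;> rfl
    simp only [hone, mul_one, one_mul] at hKone
    exact hKone
  simp only [tcb_glued_shape] at hgd
  have hgd_sum := tcb_triple_sum S cyl tb t1 t2 A12bd A1bd A2bd A0d A12d A0d A0d
  have hgU_sum := tcb_triple_sum S cyl tb t1 t2 1 1 1 1 A12u A01 A02
  have hGone := tcb_triple_sum S cyl tb t1 t2 1 1 1 1 1 1 1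
  set g12b : ℝ := ∑ T ∈ S, cyl T * (if tb T then (if t1 T then (if t2 T then (1 : ℝ) else 0) else 0) else 0) with hg12b
  set g1b : ℝ := ∑ T ∈ S, cyl T * (if tb T then (if t1 T then (if t2 T then (0 : ℝ) else 1) else 0) else 0) with hg1b
  set g2b : ℝ := ∑ T ∈ S, cyl T * (if tb T then (if t1 T then (0 : ℝ) else (if t2 T then 1 else 0)) else 0) with hg2b
  set gb : ℝ := ∑ T ∈ S, cyl T * (if tb T then (if t1 T then (0 : ℝ) else (if t2 T then 0 else 1)) else 0) with hgb
  set g12 : ℝ := ∑ T ∈ S, cyl T * (if tb T then (0 : ℝ) else (if t1 T then (if t2 T then 1 else 0) else 0)) with hg12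
  set g1 : ℝ := ∑ T ∈ S, cyl T * (if tb T then (0 : ℝ) else (if t1 T then (if t2 T then 0 else 1) else 0)) with hg1
  set g2 : ℝ := ∑ T ∈ S, cyl T * (if tb T then (0 : ℝ) else (if t1 T then 0 else 1)) with hg2
  have hSG : ∑ T ∈ S, cyl T = g12b + g1b + g2b + gb + g12 + g1 + g2 := by
    have hone : ∀ T, (if tb T then (if t1 T then (if t2 T then (1 : ℝ) else 1) else (if t2 T then 1 else 1))
        else (if t1 T then (if t2 T then 1 else 1) else 1)) = 1 := fun T => by split_ifs <;> rfl
    simp only [hone, mul_one, one_mul] at hGone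
    exact hGone
  -- nonnegativity of the masses
  have hnn : ∀ (χ : Finset (Sym2 (Fin n)) → ℝ), (∀ T, 0 ≤ χ T) → 0 ≤ ∑ T ∈ S, cyl T * χ T :=
    fun χ hχ => Finset.sum_nonneg fun T _ => mul_nonneg (hcyl_nonneg T) (hχ T)
  have huc0 : 0 ≤ uc := hnn _ fun T => by split_ifs <;> norm_num
  have hu120 : 0 ≤ u12 := hnn _ fun T => by split_ifs <;> norm_num
  have hu10 : 0 ≤ u1 := hnn _ fun T => by split_ifs <;> norm_num
  have hu20 : 0 ≤ u2 := hnn _ fun T => by split_ifs <;> norm_num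
  have hu00 : 0 ≤ u0 := hnn _ fun T => by split_ifs <;> norm_num
  have hg12b0 : 0 ≤ g12b := hnn _ fun T => by split_ifs <;> norm_num
  have hg1b0 : 0 ≤ g1b := hnn _ fun T => by split_ifs <;> norm_num
  have hg2b0 : 0 ≤ g2b := hnn _ fun T => by split_ifs <;> norm_num
  have hgb0 : 0 ≤ gb := hnn _ fun T => by split_ifs <;> norm_num
  have hg120 : 0 ≤ g12 := hnn _ fun T => by split_ifs <;> norm_num
  have hg10 : 0 ≤ g1 := hnn _ fun T => by split_ifs <;> norm_num
  have hg20 : 0 ≤ g2 := hnn _ fun T => by split_ifs <;> norm_num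
  -- cross facts between the two classifications
  have i1 : ∀ T, b1 T → tb T := fun T ⟨v, hv, _, h'⟩ => ⟨v, hv, h'⟩
  have i2 : ∀ T, b2 T → tb T := fun T ⟨v, hv, _, h'⟩ => ⟨v, hv, h'⟩
  have i12 : ∀ T, b12 T → t1 T ∧ t2 T := fun T ⟨v, hv, h, h'⟩ => ⟨⟨v, hv, h⟩, ⟨v, hv, h'⟩⟩
  have hcross1 : u1 + u2 + uc ≤ g12b + g1b + g2b + gb := tcb_cross_touched_b S cyl hcyl_nonneg tb t1 t2 b12 b1 b2 i1 i2
  have hcross2 : g1 + g2 ≤ u0 := tcb_cross_single_noBridge S cyl hcyl_nonneg tb t1 t2 b12 b1 b2 i1 i2 i12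
  -- finger-side facts: Harris and the two swap inequalities (`tcb_finger_facts`)
  obtain ⟨hHar, hswap1, hswap2⟩ : u0 ≤ Stot * (u0 + c0) ∧ g1 * u1 ≤ u0 * (gb + g1b) ∧ g2 * u2 ≤ u0 * (gb + g2b) :=
    tcb_finger_facts K N F w₁ w₂ b hw₁ hw₂ hbN h1b h2b hFdef S hS hSin (hsum K)
  -- the base rows (`tcb_row`): weak pair `w₂ < d` localised to `{d ↔ w₁}`, and the mirror image
  have hrow : (prodBernoulli q).real {ω : BondConfig (Fin n) | (openGraph ({e | e ∈ ω ∧ ∀ z ∈ e, z ∉ N} : Set (Sym2 (Fin n)))).Reachable w₂ b ∧ (openGraph ({e | e ∈ ω ∧ ∀ z ∈ e, z ∉ N} : Set (Sym2 (Fin n)))).Reachable d w₁} ≤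
      (prodBernoulli q).real {ω : BondConfig (Fin n) | (openGraph ({e | e ∈ ω ∧ ∀ z ∈ e, z ∉ N} : Set (Sym2 (Fin n)))).Reachable d b ∧ (openGraph ({e | e ∈ ω ∧ ∀ z ∈ e, z ∉ N} : Set (Sym2 (Fin n)))).Reachable d w₁} :=
    tcb_row K N w₂ w₁ d b hweak₂
  have hrow' : (prodBernoulli q).real {ω : BondConfig (Fin n) | (openGraph ({e | e ∈ ω ∧ ∀ z ∈ e, z ∉ N} : Set (Sym2 (Fin n)))).Reachable w₁ b ∧ (openGraph ({e | e ∈ ω ∧ ∀ z ∈ e, z ∉ N} : Set (Sym2 (Fin n)))).Reachable d w₂} ≤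
      (prodBernoulli q).real {ω : BondConfig (Fin n) | (openGraph ({e | e ∈ ω ∧ ∀ z ∈ e, z ∉ N} : Set (Sym2 (Fin n)))).Reachable d b ∧ (openGraph ({e | e ∈ ω ∧ ∀ z ∈ e, z ∉ N} : Set (Sym2 (Fin n)))).Reachable d w₂} :=
    tcb_row K N w₁ w₂ d b hweak₁
  -- useful scalar facts
  have hc0e : c0 = 1 - Stot := by linarith [hmass]
  have hSt1 : Stot ≤ 1 := by linarith [hmass]
  have hMb : u1 + u2 + uc ≤ g12b + g1b + g2b + gb := hcross1
  have hP1 : Stot * (u1 + u2 + uc) ≤ u1 + u2 + uc := mul_le_of_le_one_left (by linarith) hSt1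
  -- unfold the abbreviations of the base quantities (so that the integrated certificate matches syntactically)
  simp only [hA0d, hA01, hA02, hA12u, hA12d, hA1bd, hA2bd, hA12bd, hA1b12, hA2b12] at hgd hgU hτd hτ1 hτ2 hKd_sum hK1_sum hK2_sum hgd_sum hgU_sum
  have hE12u' : {ω : BondConfig (Fin n) | (openGraph ({e | e ∈ ω ∧ ∀ z ∈ e, z ∉ N} : Set (Sym2 (Fin n)))).Reachable w₂ b ∨
      (openGraph ({e | e ∈ ω ∧ ∀ z ∈ e, z ∉ N} : Set (Sym2 (Fin n)))).Reachable w₁ b} = E12u := by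
    ext ω; simp only [hE12u, Set.mem_setOf_eq]; tauto
  have hEd12' : {ω : BondConfig (Fin n) | (openGraph ({e | e ∈ ω ∧ ∀ z ∈ e, z ∉ N} : Set (Sym2 (Fin n)))).Reachable d b ∨
      ((openGraph ({e | e ∈ ω ∧ ∀ z ∈ e, z ∉ N} : Set (Sym2 (Fin n)))).Reachable w₁ b ∧
        (openGraph ({e | e ∈ ω ∧ ∀ z ∈ e, z ∉ N} : Set (Sym2 (Fin n)))).Reachable d w₂) ∨
      ((openGraph ({e | e ∈ ω ∧ ∀ z ∈ e, z ∉ N} : Set (Sym2 (Fin n)))).Reachable w₂ b ∧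
        (openGraph ({e | e ∈ ω ∧ ∀ z ∈ e, z ∉ N} : Set (Sym2 (Fin n)))).Reachable d w₁)} = Ed12 := by
    ext ω; simp only [hEd12, Set.mem_setOf_eq]; tauto
  have hEd12b' : {ω : BondConfig (Fin n) | (openGraph ({e | e ∈ ω ∧ ∀ z ∈ e, z ∉ N} : Set (Sym2 (Fin n)))).Reachable d b ∨
      (openGraph ({e | e ∈ ω ∧ ∀ z ∈ e, z ∉ N} : Set (Sym2 (Fin n)))).Reachable d w₂ ∨
      (openGraph ({e | e ∈ ω ∧ ∀ z ∈ e, z ∉ N} : Set (Sym2 (Fin n)))).Reachable d w₁} = Ed12b := by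
    ext ω; simp only [hEd12b, Set.mem_setOf_eq]; tauto
  -- the two mirror-image certificates
  rcases le_total u2 u1 with hcase | hcase
  · -- case `u2 ≤ u1`: multipliers `l1 = g1 / D1`, `l2 = Stot - l1`, row for the weak pair `w₂ < d`
    obtain ⟨l1, l2, y2, hl1, hl2, hy2, hl12, hy2def, hl1cu', hsw, hR1, hR2, hR3, hR4, hR5, hR6, hR7, hR8, hR9, hR10, hR11, hR12,
        hR13, hR14⟩ := tcb_leaves c0 u0 u12 u1 u2 uc g12b g1b g2b gb g12 g1 g2 Stot hc0_nonneg hu00 hu10 hu20 huc0 hg1b0 hg2b0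
      hgb0 hg10 hg20 hStot0 hmass hSU hSG hcross1 hcross2 hHar hswap1 hcase
    -- integrate the pointwise certificate
    have hV := stub_lincombIntegral_c7 n q _ (tcb_twoContactsB_pointwise N w₁ w₂ d b g1 g2 gb g12 g1b g2b g12b c0 u0 u12 u1 u2 uc l1 l2 y2
      hR1 hR2 hR3 hR4 hR5 hR6 hR7 hR8 hR9 hR10 hR11 hR12 hR13 hR14)
    simp only [List.map_cons, List.map_nil, List.sum_cons, List.sum_nil, probReal_univ] at hV
    simp only [← hEdb, ← hE1b, ← hE2b, ← hE12u, ← hEd12, ← hEd1b, ← hEd2b, ← hEd12b, ← hE1b12, ← hE2b12] at hV hrow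
    have h1 : 0 ≤ l1 * ((prodBernoulli K).real (openConn w₁ b) - (prodBernoulli K).real (openConn d b)) :=
      mul_nonneg hl1 (sub_nonneg.2 hle₁)
    have h2 : 0 ≤ l2 * ((prodBernoulli K).real (openConn w₂ b) - (prodBernoulli K).real (openConn d b)) :=
      mul_nonneg hl2 (sub_nonneg.2 hle₂)
    have h3 := mul_nonneg hy2 (sub_nonneg.2 hrow)
    rw [hτ1, hτd, hK1_sum, hKd_sum] at h1
    rw [hτ2, hτd, hK2_sum, hKd_sum] at h2
    rw [hgd, hgU, hgd_sum, hgU_sum]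
    linarith [hV, h1, h2, h3]
  · -- case `u1 ≤ u2`: multipliers `l2 = g2 / D2`, `l1 = Stot - l2`, row for the weak pair `w₂ < d`
    obtain ⟨l2, l1, y1, hl2, hl1, hy1, hl12, hy1def, hl2cu', hsw, hR1, hR2, hR3, hR4, hR5, hR6, hR7, hR8, hR9, hR10, hR11, hR12,
        hR13, hR14⟩ := tcb_leaves c0 u0 u12 u2 u1 uc g12b g2b g1b gb g12 g2 g1 Stot hc0_nonneg hu00 hu20 hu10 huc0 hg2b0 hg1b0
      hgb0 hg20 hg10 hStot0 hmass (by linear_combination hSU) (by linear_combination hSG) (by linarith [hcross1])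
      (by linarith [hcross2]) hHar hswap2 hcase
    -- integrate the pointwise certificate
    have hV := stub_lincombIntegral_c7 n q _ (tcb_twoContactsB_pointwise N w₂ w₁ d b g2 g1 gb g12 g2b g1b g12b c0 u0 u12 u2 u1 uc l2 l1 y1
      hR1 hR2 hR3 hR4 hR5 hR6 hR7 hR8 hR9 hR10 hR11 hR12 hR13 hR14)
    simp only [List.map_cons, List.map_nil, List.sum_cons, List.sum_nil, probReal_univ] at hV
    simp only [hE12u', hEd12', hEd12b'] at hV
    simp only [← hEdb, ← hE1b, ← hE2b, ← hEd1b, ← hEd2b, ← hE1b12, ← hE2b12] at hV hrow'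
    have h1 : 0 ≤ l2 * ((prodBernoulli K).real (openConn w₂ b) - (prodBernoulli K).real (openConn d b)) :=
      mul_nonneg hl2 (sub_nonneg.2 hle₂)
    have h2 : 0 ≤ l1 * ((prodBernoulli K).real (openConn w₁ b) - (prodBernoulli K).real (openConn d b)) :=
      mul_nonneg hl1 (sub_nonneg.2 hle₁)
    have h3 := mul_nonneg hy1 (sub_nonneg.2 hrow')
    rw [hτ2, hτd, hK2_sum, hKd_sum] at h1
    rw [hτ1, hτd, hK1_sum, hKd_sum] at h2
    rw [hgd, hgU, hgd_sum, hgU_sum]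
    linarith [hV, h1, h2, h3]

end TwoContactsBCore

end

end Summit.CriticalPhenomena.PercolationContinuityZ3.Theorems
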